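import Literature.MathematicalPhysics.QuantumManyBody.BoseEinsteinCondensation
import Summits.AtomisticToContinuum.BoseEinsteinCondensation.Theorems.BECHardSphereReductionHardCoreDominatesDiniReduction
import Summits.AtomisticToContinuum.BoseEinsteinCondensation.Theses.BECHusimiAmplitudeGas

/-!
# `ModeFreeRewardChord` (X₁ of the split of `BoundaryTransferWeak`) is an over-condensation penalty

Crux `BoundaryTransferWeak` (stmt-AtomisticToContinuum-0827) was split (D11, 2026-08-17) into
X₁ `ModeFreeRewardChord` (stmt-18443) and X₂ `ModeFreeSlopeToBEC` (stmt-18444). X₁ is stated through the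
mode-free rewarded infimum `G_N(λ) = inf_Ψ [⟨Ψ,HΨ⟩ + λ (N − λ_max(γ_Ψ))]` over Dirichlet trial states as a
two-chord inequality `G(λ) + (λ/λ₀) E₀ ≤ E₀ + (λ/λ₀) G(λ₀) + λ τ N` for all `0 < λ ≤ λ₀`, eventually in `N`.

This file proves, at every fixed `(v, N, L, τ, λ₀)`, that the two-chord inequality for all `0 < λ ≤ λ₀` is
EQUIVALENT to a variational lower bound on the energy of every trial state in terms of its condensate excess
over the UPPER condensate number of the ground state,

  `n̄ := inf_{δ>0} sup {λ_max(γ_Φ) : ⟨Φ,HΦ⟩ ≤ E₀ + δ}`   (the dual of `condensateNumber = sup_δ inf`),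

namely the OVER-CONDENSATION PENALTY `λ₀ (λ_max(γ_Ψ) − n̄ − τN) ≤ ⟨Ψ,HΨ⟩ − E₀` for every trial state `Ψ`
(written additively in `ℝ≥0∞`): `chordAt_iff_penaltyAt`. Consequently the item `ModeFreeRewardChord` is
equivalent, with the same quantifier prefix, to the statement that below some density, for every `τ > 0`, some
`λ₀ > 0` makes every Dirichlet trial state with `τN` more condensate than the ground state(s) pay energy at the
linear rate `λ₀` (`modeFreeRewardChord_iff_overCondensationPenalty`). In particular X₁ is not a soft statement:
combined with condensed competitors `o(N)` above `E₀^D` (the landed transfer `RewardPaysTheWall.stub_transfer`) it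
forces `n̄ ≥ (c − τ)N − o(N)/λ₀`, i.e. upper ground-state BEC; this is the `T = 0`, energy-currency form of the
`λ → 0⁺` / `N → ∞` interchange that LSSY App. D (p. 163) record as open ("a rigorous proof is lacking, so far").

All statements `[folklore]` (order/`ℝ≥0∞` bookkeeping over the Literature definitions); nothing here asserts X₁.

References: E. H. Lieb, R. Seiringer, J. P. Solovej, J. Yngvason, *The Mathematics of the Bose Gas and its
Condensation* (2005), §1.2 (1.17)–(1.19), App. D (D.15)–(D.19).
-/

noncomputable section

open MeasureTheory Filter
open scoped ENNReal NNReal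

namespace Summit.AtomisticToContinuum.BoseEinsteinCondensation.ModeFreeReward

open Literature.MathematicalPhysics.QuantumManyBody.BoseGas
open Summit.AtomisticToContinuum.BoseEinsteinCondensation.Cruxes.HardCoreDominates.Birth
  (maxOccupation_le_card)

section FixedN

variable {v : ℝ → ℝ≥0∞} {N : ℕ} {L : ℝ}

/-- The upper condensate number `n̄ = inf_{δ>0} sup_{δ-near-minimisers} λ_max` is at most `N`
(`λ_max ≤ N` on normalised trial states; the level `δ = 1` suffices). [folklore] -/
theorem upperCondensate_le_card (v : ℝ → ℝ≥0∞) (N : ℕ) (L : ℝ) :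
    (⨅ (δ : ℝ≥0∞) (_ : 0 < δ), ⨆ (Φ : TrialState N L)
        (_ : energy v Φ ≤ groundStateEnergy v N L + δ), maxOccupation N Φ.ψ) ≤ (N : ℝ≥0∞) :=
  (iInf₂_le (1 : ℝ≥0∞) one_pos).trans (iSup₂_le fun Φ _ => maxOccupation_le_card Φ)

/-- Every `δ`-level supremum of `λ_max` over `δ`-near-minimisers is at most `N`. [folklore] -/
theorem levelSup_le_card (v : ℝ → ℝ≥0∞) (N : ℕ) (L : ℝ) (δ : ℝ≥0∞) :
    (⨆ (Φ : TrialState N L) (_ : energy v Φ ≤ groundStateEnergy v N L + δ), maxOccupation N Φ.ψ) ≤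
      (N : ℝ≥0∞) :=
  iSup₂_le fun Φ _ => maxOccupation_le_card Φ

/-- `ℝ≥0∞` bookkeeping: `c m + c (N − m) = c N` for `m ≤ N`. [folklore] -/
theorem mul_add_mul_tsub_cancel {c m n : ℝ≥0∞} (h : m ≤ n) : c * m + c * (n - m) = c * n := by
  rw [← mul_add, add_tsub_cancel_of_le h]

/-- **Penalty ⟹ chord, step 1**: the over-condensation penalty bounds the rewarded infimum at `λ₀` from
below, `E₀ + λ₀ (N − n̄) ≤ G(λ₀) + λ₀ τ N`. [folklore] -/
theorem groundStateEnergy_add_le_G_of_penalty {lam₀ τ : ℝ}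
    (hP : ∀ Ψ : TrialState N L,
      ENNReal.ofReal lam₀ * maxOccupation N Ψ.ψ + groundStateEnergy v N L ≤
        energy v Ψ + ENNReal.ofReal lam₀ *
          (⨅ (δ : ℝ≥0∞) (_ : 0 < δ), ⨆ (Φ : TrialState N L)
            (_ : energy v Φ ≤ groundStateEnergy v N L + δ), maxOccupation N Φ.ψ) +
          ENNReal.ofReal (lam₀ * τ * N)) :
    groundStateEnergy v N L + ENNReal.ofReal lam₀ *
        ((N : ℝ≥0∞) - ⨅ (δ : ℝ≥0∞) (_ : 0 < δ), ⨆ (Φ : TrialState N L)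
            (_ : energy v Φ ≤ groundStateEnergy v N L + δ), maxOccupation N Φ.ψ) ≤
      (⨅ Ψ : TrialState N L,
          energy v Ψ + ENNReal.ofReal lam₀ * ((N : ℝ≥0∞) - maxOccupation N Ψ.ψ)) +
        ENNReal.ofReal (lam₀ * τ * N) := by
  set E₀ := groundStateEnergy v N L with hE₀
  set nbar := ⨅ (δ : ℝ≥0∞) (_ : 0 < δ), ⨆ (Φ : TrialState N L)
      (_ : energy v Φ ≤ groundStateEnergy v N L + δ), maxOccupation N Φ.ψ with hnbar
  set c := ENNReal.ofReal lam₀ with hc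
  set T := ENNReal.ofReal (lam₀ * τ * N) with hT
  have hnN : nbar ≤ N := upperCondensate_le_card v N L
  have hcN : c * (N : ℝ≥0∞) ≠ ⊤ := ENNReal.mul_ne_top ENNReal.ofReal_ne_top (ENNReal.natCast_ne_top N)
  rw [ENNReal.iInf_add]
  refine le_iInf fun Ψ => ?_
  have hmN : maxOccupation N Ψ.ψ ≤ N := maxOccupation_le_card Ψ
  set m := maxOccupation N Ψ.ψ with hm
  set a := (N : ℝ≥0∞) - nbar with ha
  set b := (N : ℝ≥0∞) - m with hb
  have h1 : c * m + c * b = c * N := mul_add_mul_tsub_cancel hmN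
  have h2 : c * nbar + c * a = c * N := mul_add_mul_tsub_cancel hnN
  have hPΨ : c * m + E₀ ≤ energy v Ψ + c * nbar + T := hP Ψ
  -- add `c b + c a` to both sides of the penalty and regroup
  have h3 : c * m + E₀ + (c * b + c * a) ≤ energy v Ψ + c * nbar + T + (c * b + c * a) :=
    add_le_add_left hPΨ _
  have h4 : c * m + E₀ + (c * b + c * a) = c * N + (E₀ + c * a) := by
    calc c * m + E₀ + (c * b + c * a) = (c * m + c * b) + (E₀ + c * a) := by ring
      _ = c * N + (E₀ + c * a) := by rw [h1]
  have h5 : energy v Ψ + c * nbar + T + (c * b + c * a) = c * N + (energy v Ψ + c * b + T) := by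
    calc energy v Ψ + c * nbar + T + (c * b + c * a)
        = (c * nbar + c * a) + (energy v Ψ + c * b + T) := by ring
      _ = c * N + (energy v Ψ + c * b + T) := by rw [h2]
  rw [h4, h5] at h3
  exact (ENNReal.add_le_add_iff_left hcN).1 h3

/-- **Penalty ⟹ chord, step 2**: the rewarded infimum is bounded above through the upper condensate number,
`G(λ) ≤ E₀ + λ (N − n̄)` for `λ > 0` (near-minimisers with `λ_max` close to the level suprema exist at every
slack; `E₀ < ⊤`). [folklore] -/
theorem G_le_groundStateEnergy_add (hE : groundStateEnergy v N L ≠ ⊤) {lam : ℝ} (hlam : 0 < lam) :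
    (⨅ Ψ : TrialState N L,
        energy v Ψ + ENNReal.ofReal lam * ((N : ℝ≥0∞) - maxOccupation N Ψ.ψ)) ≤
      groundStateEnergy v N L + ENNReal.ofReal lam *
        ((N : ℝ≥0∞) - ⨅ (δ : ℝ≥0∞) (_ : 0 < δ), ⨆ (Φ : TrialState N L)
            (_ : energy v Φ ≤ groundStateEnergy v N L + δ), maxOccupation N Φ.ψ) := by
  set E₀ := groundStateEnergy v N L with hE₀
  set nbar := ⨅ (δ : ℝ≥0∞) (_ : 0 < δ), ⨆ (Φ : TrialState N L)
      (_ : energy v Φ ≤ groundStateEnergy v N L + δ), maxOccupation N Φ.ψ with hnbar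
  set c := ENNReal.ofReal lam with hc
  have hnN : nbar ≤ N := upperCondensate_le_card v N L
  have hntop : nbar ≠ ⊤ := ne_top_of_le_ne_top (ENNReal.natCast_ne_top N) hnN
  refine ENNReal.le_of_forall_pos_le_add fun ε hε _ => ?_
  -- slack `ε/2` in energy, `ε/2` in the reward
  have hε2 : (0 : ℝ≥0∞) < (ε : ℝ≥0∞) / 2 := ENNReal.half_pos (by exact_mod_cast hε.ne')
  set δ : ℝ≥0∞ := (ε : ℝ≥0∞) / 2 with hδ
  set S := ⨆ (Φ : TrialState N L) (_ : energy v Φ ≤ E₀ + δ), maxOccupation N Φ.ψ with hS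
  have hnS : nbar ≤ S := iInf₂_le δ hε2
  -- the reward slack as an occupation deficit `x = (ε/2)/λ`, so that `c x = ε/2`
  set x : ℝ≥0∞ := δ / c with hx
  have hc0 : c ≠ 0 := by rw [hc]; exact (ENNReal.ofReal_pos.2 hlam).ne'
  have hctop : c ≠ ⊤ := ENNReal.ofReal_ne_top
  have hcx : c * x = δ := ENNReal.mul_div_cancel hc0 hctop
  -- a near-minimiser `Φ` with `nbar ≤ λ_max(Φ) + x`
  obtain ⟨Φ, hΦE, hΦm⟩ : ∃ Φ : TrialState N L, energy v Φ ≤ E₀ + δ ∧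
      nbar ≤ maxOccupation N Φ.ψ + x := by
    by_cases hS0 : S = 0
    · -- then `nbar = 0`; any `δ`-near-minimiser will do
      have hn0 : nbar = 0 := le_antisymm (hnS.trans hS0.le) bot_le
      obtain ⟨Φ, hΦ⟩ := iInf_lt_iff.1 (ENNReal.lt_add_right hE hε2.ne')
      exact ⟨Φ, hΦ.le, by rw [hn0]; exact bot_le⟩
    · -- `b := nbar - x < S`, so some admissible `Φ` has `b < λ_max(Φ)`
      set b := nbar - x with hb
      have hbS : b < S := by
        by_cases hle : nbar ≤ x
        · rw [hb, tsub_eq_zero_of_le hle]; exact pos_iff_ne_zero.2 hS0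
        · have hx0 : 0 < x := by
            rw [hx]; exact ENNReal.div_pos hε2.ne' hctop
          exact (ENNReal.sub_lt_self hntop (fun h => hle (h ▸ bot_le)) hx0.ne').trans_le hnS
      obtain ⟨Φ, hΦ⟩ := lt_iSup_iff.1 hbS
      have hΦE : energy v Φ ≤ E₀ + δ := by
        by_contra h
        simp [h] at hΦ
      rw [iSup_pos hΦE] at hΦ
      exact ⟨Φ, hΦE, tsub_le_iff_right.1 hΦ.le⟩
  -- evaluate the rewarded functional at `Φ`
  have hdef : (N : ℝ≥0∞) - maxOccupation N Φ.ψ ≤ ((N : ℝ≥0∞) - nbar) + x :=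
    (tsub_le_tsub_left (tsub_le_iff_right.2 hΦm) _).trans tsub_tsub_le_tsub_add
  calc (⨅ Ψ : TrialState N L, energy v Ψ + c * ((N : ℝ≥0∞) - maxOccupation N Ψ.ψ))
      ≤ energy v Φ + c * ((N : ℝ≥0∞) - maxOccupation N Φ.ψ) := iInf_le _ Φ
    _ ≤ (E₀ + δ) + c * (((N : ℝ≥0∞) - nbar) + x) := add_le_add hΦE (mul_le_mul_right hdef _)
    _ = E₀ + c * ((N : ℝ≥0∞) - nbar) + (δ + δ) := by rw [mul_add, hcx]; ring
    _ = E₀ + c * ((N : ℝ≥0∞) - nbar) + ε := by rw [hδ, ENNReal.add_halves]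

/-- **Penalty ⟹ chord.** At fixed `(v, N, L)`: if every trial state pays the over-condensation penalty
`λ₀ λ_max(γ_Ψ) + E₀ ≤ ⟨Ψ,HΨ⟩ + λ₀ n̄ + λ₀ τ N`, then the two-chord inequality
`G(λ) + (λ/λ₀) E₀ ≤ E₀ + (λ/λ₀) G(λ₀) + λ τ N` holds for every `0 < λ ≤ λ₀` (indeed for every `λ > 0`).
[folklore] -/
theorem chordAt_of_penaltyAt {lam₀ τ : ℝ} (hlam₀ : 0 < lam₀)
    (hP : ∀ Ψ : TrialState N L,
      ENNReal.ofReal lam₀ * maxOccupation N Ψ.ψ + groundStateEnergy v N L ≤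
        energy v Ψ + ENNReal.ofReal lam₀ *
          (⨅ (δ : ℝ≥0∞) (_ : 0 < δ), ⨆ (Φ : TrialState N L)
            (_ : energy v Φ ≤ groundStateEnergy v N L + δ), maxOccupation N Φ.ψ) +
          ENNReal.ofReal (lam₀ * τ * N)) :
    ∀ lam : ℝ, 0 < lam →
      (⨅ Ψ : TrialState N L, energy v Ψ + ENNReal.ofReal lam * ((N : ℝ≥0∞) - maxOccupation N Ψ.ψ)) +
          ENNReal.ofReal (lam / lam₀) * groundStateEnergy v N L ≤
        groundStateEnergy v N L + ENNReal.ofReal (lam / lam₀) *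
          (⨅ Ψ : TrialState N L,
            energy v Ψ + ENNReal.ofReal lam₀ * ((N : ℝ≥0∞) - maxOccupation N Ψ.ψ)) +
          ENNReal.ofReal (lam * τ * N) := by
  intro lam hlam
  set E₀ := groundStateEnergy v N L with hE₀
  set nbar := ⨅ (δ : ℝ≥0∞) (_ : 0 < δ), ⨆ (Φ : TrialState N L)
      (_ : energy v Φ ≤ groundStateEnergy v N L + δ), maxOccupation N Φ.ψ with hnbar
  set G₀ := ⨅ Ψ : TrialState N L,
      energy v Ψ + ENNReal.ofReal lam₀ * ((N : ℝ≥0∞) - maxOccupation N Ψ.ψ) with hG₀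
  set r := ENNReal.ofReal (lam / lam₀) with hr
  by_cases hE : E₀ = ⊤
  · -- everything is `⊤`
    rw [hE, top_add, top_add]
    exact le_top
  -- step 2: `G(λ) ≤ E₀ + λ (N − n̄)`; step 1: `E₀ + λ₀ (N − n̄) ≤ G(λ₀) + λ₀ τ N`
  have h2 := G_le_groundStateEnergy_add (v := v) (N := N) (L := L) hE hlam
  have h1 := groundStateEnergy_add_le_G_of_penalty (v := v) (N := N) (L := L) hP
  -- `ofReal λ = r · ofReal λ₀` and `r · ofReal (λ₀ τ N) = ofReal (λ τ N)`
  have hrr : ENNReal.ofReal lam = r * ENNReal.ofReal lam₀ := by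
    rw [hr, ← ENNReal.ofReal_mul (div_nonneg hlam.le hlam₀.le), div_mul_cancel₀ lam hlam₀.ne']
  have hrT : r * ENNReal.ofReal (lam₀ * τ * N) = ENNReal.ofReal (lam * τ * N) := by
    rw [hr, ← ENNReal.ofReal_mul (div_nonneg hlam.le hlam₀.le)]
    congr 1
    field_simp
  calc (⨅ Ψ : TrialState N L, energy v Ψ + ENNReal.ofReal lam * ((N : ℝ≥0∞) - maxOccupation N Ψ.ψ)) +
          r * E₀
      ≤ (E₀ + ENNReal.ofReal lam * ((N : ℝ≥0∞) - nbar)) + r * E₀ := add_le_add_left h2 _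
    _ = E₀ + r * (E₀ + ENNReal.ofReal lam₀ * ((N : ℝ≥0∞) - nbar)) := by rw [hrr]; ring
    _ ≤ E₀ + r * (G₀ + ENNReal.ofReal (lam₀ * τ * N)) :=
        add_le_add_right (mul_le_mul_right h1 r) E₀
    _ = E₀ + r * G₀ + ENNReal.ofReal (lam * τ * N) := by rw [mul_add, hrT, add_assoc]

/-- **Chord ⟹ penalty.** At fixed `(v, N, L)`: if the two-chord inequality holds for all `0 < λ ≤ λ₀`, then every
trial state pays the over-condensation penalty `λ₀ λ_max(γ_Ψ) + E₀ ≤ ⟨Ψ,HΨ⟩ + λ₀ n̄ + λ₀ τ N`. Mechanism: for a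
level `δ` with `E₀ + δ < ⟨Ψ₁,HΨ₁⟩`, a reward `λ < δ/N` cannot be paid for by leaving the `δ`-near-minimisers, so
`G(λ) ≥ E₀ + λ (N − S_δ)` with `S_δ` the level supremum of `λ_max`; the chord at `λ` and `G(λ₀) ≤ ⟨Ψ₁,(H + λ₀(N −
λ_max))Ψ₁⟩` then give the penalty with `S_δ` in place of `n̄`, and `n̄ = inf_δ S_δ`. [folklore] -/
theorem penaltyAt_of_chordAt {lam₀ τ : ℝ} (hlam₀ : 0 < lam₀)
    (hC : ∀ lam : ℝ, 0 < lam → lam ≤ lam₀ →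
      (⨅ Ψ : TrialState N L, energy v Ψ + ENNReal.ofReal lam * ((N : ℝ≥0∞) - maxOccupation N Ψ.ψ)) +
          ENNReal.ofReal (lam / lam₀) * groundStateEnergy v N L ≤
        groundStateEnergy v N L + ENNReal.ofReal (lam / lam₀) *
          (⨅ Ψ : TrialState N L,
            energy v Ψ + ENNReal.ofReal lam₀ * ((N : ℝ≥0∞) - maxOccupation N Ψ.ψ)) +
          ENNReal.ofReal (lam * τ * N)) :
    ∀ Ψ : TrialState N L,
      ENNReal.ofReal lam₀ * maxOccupation N Ψ.ψ + groundStateEnergy v N L ≤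
        energy v Ψ + ENNReal.ofReal lam₀ *
          (⨅ (δ : ℝ≥0∞) (_ : 0 < δ), ⨆ (Φ : TrialState N L)
            (_ : energy v Φ ≤ groundStateEnergy v N L + δ), maxOccupation N Φ.ψ) +
          ENNReal.ofReal (lam₀ * τ * N) := by
  intro Ψ₁
  set E₀ := groundStateEnergy v N L with hE₀
  set G₀ := ⨅ Ψ : TrialState N L,
      energy v Ψ + ENNReal.ofReal lam₀ * ((N : ℝ≥0∞) - maxOccupation N Ψ.ψ) with hG₀
  set c := ENNReal.ofReal lam₀ with hc
  set T := ENNReal.ofReal (lam₀ * τ * N) with hT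
  set m₁ := maxOccupation N Ψ₁.ψ with hm₁
  set e₁ := energy v Ψ₁ with he₁
  have hc0 : c ≠ 0 := by rw [hc]; exact (ENNReal.ofReal_pos.2 hlam₀).ne'
  have hctop : c ≠ ⊤ := ENNReal.ofReal_ne_top
  have hE₀e₁ : E₀ ≤ e₁ := groundStateEnergy_le_energy v Ψ₁
  have hm₁N : m₁ ≤ N := maxOccupation_le_card Ψ₁
  have hcN : c * (N : ℝ≥0∞) ≠ ⊤ := ENNReal.mul_ne_top hctop (ENNReal.natCast_ne_top N)
  -- trivial cases: `e₁ = ⊤` (covers `E₀ = ⊤`)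
  by_cases he : e₁ = ⊤
  · rw [he, top_add, top_add]; exact le_top
  have hE : E₀ ≠ ⊤ := ne_top_of_le_ne_top he hE₀e₁
  -- distribute `c` and the additions over the infimum defining `n̄`
  rw [ENNReal.mul_iInf_of_ne hc0 hctop, ENNReal.add_iInf, ENNReal.iInf_add]
  refine le_iInf fun δ => ?_
  rw [ENNReal.mul_iInf_of_ne hc0 hctop, ENNReal.add_iInf, ENNReal.iInf_add]
  refine le_iInf fun hδ => ?_
  set S := ⨆ (Φ : TrialState N L) (_ : energy v Φ ≤ E₀ + δ), maxOccupation N Φ.ψ with hS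
  have hSN : S ≤ N := levelSup_le_card v N L δ
  -- if `Ψ₁` is itself `δ`-near, `m₁ ≤ S` and we are done
  by_cases hnear : e₁ ≤ E₀ + δ
  · have hm₁S : m₁ ≤ S := le_iSup₂_of_le (f := fun (Φ : TrialState N L)
        (_ : energy v Φ ≤ E₀ + δ) => maxOccupation N Φ.ψ) Ψ₁ hnear le_rfl
    calc c * m₁ + E₀ ≤ c * S + e₁ := add_le_add (mul_le_mul_right hm₁S c) hE₀e₁
      _ = e₁ + c * S := add_comm _ _
      _ ≤ e₁ + c * S + T := le_self_add
  -- otherwise `E₀ + δ < e₁ < ⊤`, so `δ` is finite and positive; reward `λ = min λ₀ (δ/(2N))`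
  have hδtop : δ ≠ ⊤ := by
    intro h; exact hnear (by rw [h, add_top]; exact le_top)
  have hδr : 0 < δ.toReal := ENNReal.toReal_pos hδ.ne' hδtop
  -- the case `N = 0` is trivial (`m₁ ≤ 0`)
  rcases Nat.eq_zero_or_pos N with hN0 | hNpos
  · have hm0 : m₁ = 0 := le_antisymm (by simpa [hN0] using hm₁N) bot_le
    rw [hm0, mul_zero, zero_add]
    exact hE₀e₁.trans (le_self_add.trans le_self_add)
  have hNr : (0 : ℝ) < N := Nat.cast_pos.2 hNpos
  set lam : ℝ := min lam₀ (δ.toReal / (2 * N)) with hlam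
  have hlam0 : 0 < lam := lt_min hlam₀ (div_pos hδr (by positivity))
  have hlamle : lam ≤ lam₀ := min_le_left _ _
  have hlamN : ENNReal.ofReal lam * (N : ℝ≥0∞) ≤ δ := by
    have h1 : lam * N ≤ δ.toReal / 2 := by
      calc lam * N ≤ δ.toReal / (2 * N) * N := mul_le_mul_of_nonneg_right (min_le_right _ _) hNr.le
        _ = δ.toReal / 2 := by field_simp
    have h2 : δ.toReal / 2 ≤ δ.toReal := by linarith
    calc ENNReal.ofReal lam * (N : ℝ≥0∞) = ENNReal.ofReal (lam * N) := by
          rw [ENNReal.ofReal_mul hlam0.le, ENNReal.ofReal_natCast]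
      _ ≤ ENNReal.ofReal δ.toReal := ENNReal.ofReal_le_ofReal (h1.trans h2)
      _ = δ := ENNReal.ofReal_toReal hδtop
  set c' := ENNReal.ofReal lam with hc'
  set r := ENNReal.ofReal (lam / lam₀) with hr
  have hr0 : r ≠ 0 := by rw [hr]; exact (ENNReal.ofReal_pos.2 (div_pos hlam0 hlam₀)).ne'
  have hrtop : r ≠ ⊤ := ENNReal.ofReal_ne_top
  have hrr : c' = r * c := by
    rw [hr, hc, ← ENNReal.ofReal_mul (div_nonneg hlam0.le hlam₀.le), div_mul_cancel₀ lam hlam₀.ne']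
  have hrT : r * T = ENNReal.ofReal (lam * τ * N) := by
    rw [hr, hT, ← ENNReal.ofReal_mul (div_nonneg hlam0.le hlam₀.le)]
    congr 1
    field_simp
  -- lower bound: `E₀ + λ (N − S) ≤ G(λ)`
  have hlow : E₀ + c' * ((N : ℝ≥0∞) - S) ≤
      ⨅ Ψ : TrialState N L, energy v Ψ + c' * ((N : ℝ≥0∞) - maxOccupation N Ψ.ψ) := by
    refine le_iInf fun Φ => ?_
    by_cases hΦ : energy v Φ ≤ E₀ + δ
    · have hmS : maxOccupation N Φ.ψ ≤ S := le_iSup₂_of_le (f := fun (Φ : TrialState N L)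
          (_ : energy v Φ ≤ E₀ + δ) => maxOccupation N Φ.ψ) Φ hΦ le_rfl
      exact add_le_add (groundStateEnergy_le_energy v Φ) (mul_le_mul_right (tsub_le_tsub_left hmS _) _)
    · push Not at hΦ
      calc E₀ + c' * ((N : ℝ≥0∞) - S) ≤ E₀ + c' * N := add_le_add_right (mul_le_mul_right tsub_le_self _) _
        _ ≤ E₀ + δ := add_le_add_right hlamN _
        _ ≤ energy v Φ := hΦ.le
        _ ≤ energy v Φ + c' * ((N : ℝ≥0∞) - maxOccupation N Φ.ψ) := le_self_add
  -- upper bound from the chord at `λ` and `G(λ₀) ≤ e₁ + c (N − m₁)`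
  have hG₀ : G₀ ≤ e₁ + c * ((N : ℝ≥0∞) - m₁) := iInf_le _ Ψ₁
  have hup : (⨅ Ψ : TrialState N L, energy v Ψ + c' * ((N : ℝ≥0∞) - maxOccupation N Ψ.ψ)) + r * E₀ ≤
      E₀ + r * (e₁ + c * ((N : ℝ≥0∞) - m₁)) + r * T := by
    calc (⨅ Ψ : TrialState N L, energy v Ψ + c' * ((N : ℝ≥0∞) - maxOccupation N Ψ.ψ)) + r * E₀
        ≤ E₀ + r * G₀ + ENNReal.ofReal (lam * τ * N) := hC lam hlam0 hlamle
      _ ≤ E₀ + r * (e₁ + c * ((N : ℝ≥0∞) - m₁)) + r * T := by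
          rw [hrT]; exact add_le_add_left (add_le_add_right (mul_le_mul_right hG₀ r) _) _
  -- combine: `E₀ + c'(N − S) + r E₀ ≤ E₀ + r (e₁ + c (N − m₁)) + r T`, cancel `E₀`, then `r`
  have hcomb : E₀ + (c' * ((N : ℝ≥0∞) - S) + r * E₀) ≤ E₀ + (r * (e₁ + c * ((N : ℝ≥0∞) - m₁)) + r * T) := by
    calc E₀ + (c' * ((N : ℝ≥0∞) - S) + r * E₀) = (E₀ + c' * ((N : ℝ≥0∞) - S)) + r * E₀ := by ring
      _ ≤ E₀ + r * (e₁ + c * ((N : ℝ≥0∞) - m₁)) + r * T := (add_le_add_left hlow _).trans hup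
      _ = E₀ + (r * (e₁ + c * ((N : ℝ≥0∞) - m₁)) + r * T) := by ring
  have hcomb' : c' * ((N : ℝ≥0∞) - S) + r * E₀ ≤ r * (e₁ + c * ((N : ℝ≥0∞) - m₁)) + r * T :=
    (ENNReal.add_le_add_iff_left hE).1 hcomb
  have hcomb'' : r * (c * ((N : ℝ≥0∞) - S) + E₀) ≤ r * (e₁ + c * ((N : ℝ≥0∞) - m₁) + T) := by
    calc r * (c * ((N : ℝ≥0∞) - S) + E₀) = c' * ((N : ℝ≥0∞) - S) + r * E₀ := by rw [hrr]; ring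
      _ ≤ r * (e₁ + c * ((N : ℝ≥0∞) - m₁)) + r * T := hcomb'
      _ = r * (e₁ + c * ((N : ℝ≥0∞) - m₁) + T) := by ring
  have hkey : c * ((N : ℝ≥0∞) - S) + E₀ ≤ e₁ + c * ((N : ℝ≥0∞) - m₁) + T :=
    (ENNReal.mul_le_mul_iff_right hr0 hrtop).1 hcomb''
  -- add `c S + c m₁` to both sides and cancel `c N`
  set a := (N : ℝ≥0∞) - S with ha
  set b := (N : ℝ≥0∞) - m₁ with hb
  have h1 : c * S + c * a = c * N := mul_add_mul_tsub_cancel hSN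
  have h2 : c * m₁ + c * b = c * N := mul_add_mul_tsub_cancel hm₁N
  have h3 : c * a + E₀ + (c * S + c * m₁) ≤ e₁ + c * b + T + (c * S + c * m₁) := add_le_add_left hkey _
  have h4 : c * a + E₀ + (c * S + c * m₁) = c * N + (c * m₁ + E₀) := by
    calc c * a + E₀ + (c * S + c * m₁) = (c * S + c * a) + (c * m₁ + E₀) := by ring
      _ = c * N + (c * m₁ + E₀) := by rw [h1]
  have h5 : e₁ + c * b + T + (c * S + c * m₁) = c * N + (e₁ + c * S + T) := by
    calc e₁ + c * b + T + (c * S + c * m₁) = (c * m₁ + c * b) + (e₁ + c * S + T) := by ring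
      _ = c * N + (e₁ + c * S + T) := by rw [h2]
  rw [h4, h5] at h3
  exact (ENNReal.add_le_add_iff_left hcN).1 h3

/-- **The two-chord inequality for all `0 < λ ≤ λ₀` is equivalent to the over-condensation penalty** (fixed
`v, N, L`, `λ₀ > 0`, any real `τ`). [folklore] -/
theorem chordAt_iff_penaltyAt {lam₀ τ : ℝ} (hlam₀ : 0 < lam₀) :
    (∀ lam : ℝ, 0 < lam → lam ≤ lam₀ →
      (⨅ Ψ : TrialState N L, energy v Ψ + ENNReal.ofReal lam * ((N : ℝ≥0∞) - maxOccupation N Ψ.ψ)) +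
          ENNReal.ofReal (lam / lam₀) * groundStateEnergy v N L ≤
        groundStateEnergy v N L + ENNReal.ofReal (lam / lam₀) *
          (⨅ Ψ : TrialState N L,
            energy v Ψ + ENNReal.ofReal lam₀ * ((N : ℝ≥0∞) - maxOccupation N Ψ.ψ)) +
          ENNReal.ofReal (lam * τ * N)) ↔
    (∀ Ψ : TrialState N L,
      ENNReal.ofReal lam₀ * maxOccupation N Ψ.ψ + groundStateEnergy v N L ≤
        energy v Ψ + ENNReal.ofReal lam₀ *
          (⨅ (δ : ℝ≥0∞) (_ : 0 < δ), ⨆ (Φ : TrialState N L)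
            (_ : energy v Φ ≤ groundStateEnergy v N L + δ), maxOccupation N Φ.ψ) +
          ENNReal.ofReal (lam₀ * τ * N)) :=
  ⟨penaltyAt_of_chordAt hlam₀, fun hP lam hlam _ => chordAt_of_penaltyAt hlam₀ hP lam hlam⟩

end FixedN

/-! ## The item-level equivalence -/

/-- **`ModeFreeRewardChord` (stmt-AtomisticToContinuum-18443, X₁ of the split of `BoundaryTransferWeak`) is
equivalent to the OVER-CONDENSATION PENALTY**: for every repulsive finite-range `v`, below some density, for
every `τ > 0` some `λ₀ > 0` makes, eventually in `N`, every Dirichlet trial state `Ψ` in the box of side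
`(N/ρ)^{1/3}` satisfy `λ₀ λ_max(γ_Ψ) + E₀ ≤ ⟨Ψ,HΨ⟩ + λ₀ n̄_N + λ₀ τ N`, where
`n̄_N = inf_{δ>0} sup {λ_max(γ_Φ) : ⟨Φ,HΦ⟩ ≤ E₀ + δ}` is the upper condensate number of the ground state(s)
(same quantifier prefix on both sides; pointwise `chordAt_iff_penaltyAt`). [folklore] -/
theorem modeFreeRewardChord_iff_overCondensationPenalty :
    Summit.AtomisticToContinuum.BoseEinsteinCondensation.Theses.BECHusimiAmplitudeGas.ModeFreeRewardChord ↔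
    ∀ v : ℝ → ℝ≥0∞, IsRepulsiveFiniteRange v → ∃ ρ₁ : ℝ, 0 < ρ₁ ∧ ∀ ρ : ℝ, 0 < ρ → ρ < ρ₁ →
      ∀ τ : ℝ, 0 < τ → ∃ lam₀ : ℝ, 0 < lam₀ ∧ ∀ᶠ N : ℕ in atTop,
        ∀ Ψ : TrialState N (sideLength ρ N),
          ENNReal.ofReal lam₀ * maxOccupation N Ψ.ψ + groundStateEnergy v N (sideLength ρ N) ≤
            energy v Ψ + ENNReal.ofReal lam₀ *
              (⨅ (δ : ℝ≥0∞) (_ : 0 < δ), ⨆ (Φ : TrialState N (sideLength ρ N))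
                (_ : energy v Φ ≤ groundStateEnergy v N (sideLength ρ N) + δ), maxOccupation N Φ.ψ) +
              ENNReal.ofReal (lam₀ * τ * N) := by
  unfold Summit.AtomisticToContinuum.BoseEinsteinCondensation.Theses.BECHusimiAmplitudeGas.ModeFreeRewardChord
  refine forall₂_congr fun v _ => exists_congr fun ρ₁ => and_congr_right fun _ => ?_
  refine forall₃_congr fun ρ _ _ => forall₂_congr fun τ _ => exists_congr fun lam₀ => ?_
  refine and_congr_right fun hlam₀ => Filter.eventually_congr (Filter.Eventually.of_forall fun N => ?_)
  exact chordAt_iff_penaltyAt hlam₀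

end Summit.AtomisticToContinuum.BoseEinsteinCondensation.ModeFreeReward

end
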